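import Literature.NumberTheory.NumberFields.HilbertClassFieldArtinEquivariance
import HarnessLib

/-!
# If `Gal(K/k)` acts trivially on `Cl(K)/p`, then `Gal(H_K/K)/p` is CENTRAL in `Gal(H_K/k)`
# (a corollary of the equivariance of the Artin isomorphism; proved)

`Proofs`-style file (theorems only: no definition, no named fact, no `sorry`) in topic `NumberTheory/NumberFields`
(namespace `Literature.NumberTheory.NumberFields.hilbertClassField`), written by the literature seat `bsd-potss-conjA-anchor` g20
(cell `bsd-potss`; serves the asides stmt-BirchSwinnertonDyer-19386 / 19413; closes nothing).  `H = hilbertClassField K ⊆ K̄` with its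
Artin isomorphism `artinEquiv K : Cl(𝓞 K) ≃* Gal(H/K)` (tree `HilbertClassFieldArtinIsomorphism`), an automorphism `σ` of `K` acting on
`Cl(𝓞 K)` through `ClassGroup.mulEquiv (AmbiguousClass.intAut σ)` (tree `AmbiguousClassGaloisAction`), and the equivariance
`(H/K, σ𝔞) = τ̃ (H/K, 𝔞) τ̃⁻¹` for every automorphism `τ̃` of `H` over `σ` (tree `artinEquiv_mulEquiv_intAut_apply`, Neukirch IV §6 / VI (7.1)).

* `exists_eq_pow_mul_of_classGroup_mulEquiv` — if `σ` acts trivially on `Cl(K)/Cl(K)^p` (`σc · c⁻¹ ∈ Cl^p` for all `c`), then for every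
  `τ̃ ∈ Aut(H)` over `σ` and every `a ∈ Gal(H/K)`: `τ̃ a τ̃⁻¹ = e^p · a` for some `e ∈ Gal(H/K)`;
* `commutator_top_range_le_closure_pow_of_classGroup_mulEquiv` — `k ⊆ K` with `K/k` normal: if EVERY `σ ∈ Gal(K/k)` acts trivially on
  `Cl(K)/p`, then `⁅Gal(H/k), Gal(H/K)⁆ ≤ ⟨x^p : x ∈ Gal(H/K)⟩` inside `Gal(H/k)` (`Gal(H/K)` embedded by restriction of scalars), i.e. the
  maximal unramified elementary-abelian `p`-extension of `K` has Galois group over `K` CENTRAL in its Galois group over `k`.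
This is step (iii-a) of the cell's successor door L11 («`Gal(K_{n₀+1}/K_{n₀})` acts trivially on `Cl(K_{n₀+1})/p` ⟹ `μ = 0`», memo
conjA-anchor g20 door-L10 §3): the displayed class-group hypothesis of a record becomes the centrality hypothesis of
`FukudaGroup.relIndex_layer_le_of_commutator_le`, up to the transport into Fukuda's package.

References: [NeukirchANT1999] Ch. IV §6 (functoriality of the norm residue symbol), Ch. VI §7 Thm. (7.1); [Cox2013] §8.A Thm. 8.10;
[Washington1997] §13.3 (the `Γ`-module `X/(ν_n Y + pX) ≅ A_n/p`).
-/

set_option autoImplicit false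

noncomputable section

open NumberField
open scoped Pointwise commutatorElement

namespace Literature.NumberTheory.NumberFields.hilbertClassField

variable (K : Type) [Field K] [NumberField K]
variable {E E' : Type*} [Field E] [Field E'] [Algebra E (hilbertClassField K)] [Algebra E' K]

/-- **`σ` trivial on `Cl(K)/p` ⟹ conjugation by a lift of `σ` is trivial on `Gal(H/K)` modulo `p`-th powers**: if
`σc · c⁻¹ ∈ Cl(𝓞 K)^p` for every class `c`, then for every automorphism `τ̃` of `H = hilbertClassField K` restricting to `σ` on `K`
and every `a ∈ Gal(H/K)`, the conjugate `τ̃ a τ̃⁻¹` (the `K`-automorphism `a'` with `a' y = τ̃ (a (τ̃⁻¹ y))`) equals `e^p · a` for some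
`e ∈ Gal(H/K)` (namely `e = (H/K, d)` where `σc = d^p c`, `c = (H/K, ·)⁻¹ a`).
[cite: NeukirchANT1999, Ch. IV §6 and Ch. VI §7 Thm. (7.1) (equivariance of the Artin symbol)] [cite: Cox2013, §8.A Thm. 8.10] -/
theorem exists_eq_pow_mul_of_classGroup_mulEquiv (p : ℕ) (τ : hilbertClassField K ≃ₐ[E] hilbertClassField K)
    (σ : K ≃ₐ[E'] K)
    (hτ : ∀ x : K, τ (algebraMap K (hilbertClassField K) x) = algebraMap K (hilbertClassField K) (σ x))
    (hσ : ∀ c : ClassGroup (𝓞 K),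
      ClassGroup.mulEquiv (AmbiguousClass.intAut σ) c * c⁻¹ ∈ (powMonoidHom p : ClassGroup (𝓞 K) →* ClassGroup (𝓞 K)).range)
    (a a' : hilbertClassField K ≃ₐ[K] hilbertClassField K) (ha' : ∀ y, a' y = τ (a (τ.symm y))) :
    ∃ e : hilbertClassField K ≃ₐ[K] hilbertClassField K, a' = e ^ p * a := by
  set c : ClassGroup (𝓞 K) := (artinEquiv K).symm a with hcdef
  have hc : artinEquiv K c = a := (artinEquiv K).apply_symm_apply a
  obtain ⟨d, hd⟩ := hσ c
  rw [powMonoidHom_apply] at hd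
  have hσc : ClassGroup.mulEquiv (AmbiguousClass.intAut σ) c = d ^ p * c := by
    rw [hd, inv_mul_cancel_right]
  refine ⟨artinEquiv K d, AlgEquiv.ext fun y => ?_⟩
  have key := artinEquiv_mulEquiv_intAut_apply K τ σ hτ c y
  rw [hσc, map_mul, map_pow, hc] at key
  rw [ha', ← key]

/-! ## The commutator form inside `Gal(H/k)` -/

section Tower

variable {k : Type*} [Field k] [Algebra k K] [Algebra k (hilbertClassField K)]
  [IsScalarTower k K (hilbertClassField K)] [Normal k K]

/-- For `τ̃ ∈ Aut(H/k)` and `a ∈ Aut(H/K)` (`K/k` normal) the conjugate `τ̃ a τ̃⁻¹` is `K`-linear. [folklore] -/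
private theorem exists_conj'' (τ : hilbertClassField K ≃ₐ[k] hilbertClassField K)
    (a : hilbertClassField K ≃ₐ[K] hilbertClassField K) :
    ∃ a' : hilbertClassField K ≃ₐ[K] hilbertClassField K, ∀ y, a' y = τ (a (τ.symm y)) := by
  refine ⟨AlgEquiv.ofRingEquiv (f := τ.symm.toRingEquiv.trans (a.toRingEquiv.trans τ.toRingEquiv)) fun x => ?_,
    fun y => rfl⟩
  change τ (a (τ.symm (algebraMap K (hilbertClassField K) x))) = algebraMap K (hilbertClassField K) x
  have h1 : τ.symm (algebraMap K (hilbertClassField K) x) =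
      algebraMap K (hilbertClassField K) ((τ.restrictNormal K).symm x) := by
    apply τ.injective
    rw [AlgEquiv.apply_symm_apply, ← AlgEquiv.restrictNormal_commutes, AlgEquiv.apply_symm_apply]
  rw [h1, AlgEquiv.commutes, ← AlgEquiv.restrictNormal_commutes, AlgEquiv.apply_symm_apply]

/-- **Centrality modulo `p`-th powers**: `K/k` normal, `H = hilbertClassField K`; if every `σ ∈ Gal(K/k)` acts trivially on
`Cl(𝓞 K)/p`, then `⁅Gal(H/k), Gal(H/K)⁆ ≤ ⟨x^p : x ∈ Gal(H/K)⟩` in `Gal(H/k)` (with `Gal(H/K) ↪ Gal(H/k)` by restriction of scalars,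
a monoid morphism `ρ`): the Galois group over `K` of the maximal unramified elementary-abelian `p`-extension of `K` is central in its
Galois group over `k`. [cite: NeukirchANT1999, Ch. IV §6 and Ch. VI §7 Thm. (7.1)] [cite: Cox2013, §8.A Thm. 8.10] -/
theorem commutator_top_range_le_closure_pow_of_classGroup_mulEquiv (p : ℕ)
    (hσ : ∀ (σ : K ≃ₐ[k] K) (c : ClassGroup (𝓞 K)),
      ClassGroup.mulEquiv (AmbiguousClass.intAut σ) c * c⁻¹ ∈ (powMonoidHom p : ClassGroup (𝓞 K) →* ClassGroup (𝓞 K)).range)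
    (ρ : (hilbertClassField K ≃ₐ[K] hilbertClassField K) →* (hilbertClassField K ≃ₐ[k] hilbertClassField K))
    (hρ : ∀ a y, ρ a y = a y) :
    ⁅(⊤ : Subgroup (hilbertClassField K ≃ₐ[k] hilbertClassField K)), ρ.range⁆ ≤
      Subgroup.closure ((fun x => x ^ p) '' (ρ.range : Set (hilbertClassField K ≃ₐ[k] hilbertClassField K))) := by
  rw [Subgroup.commutator_le]
  intro τ _ b hb
  obtain ⟨a, rfl⟩ := MonoidHom.mem_range.mp hb
  -- `τ` restricts to `σ = τ|_K` on `K`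
  have hτ : ∀ x : K, τ (algebraMap K (hilbertClassField K) x) =
      algebraMap K (hilbertClassField K) (τ.restrictNormal K x) := fun x =>
    (AlgEquiv.restrictNormal_commutes τ K x).symm
  obtain ⟨a', ha'⟩ := exists_conj'' K τ a
  obtain ⟨e, he⟩ := exists_eq_pow_mul_of_classGroup_mulEquiv K p τ (τ.restrictNormal K) hτ (hσ _) a a' ha'
  -- `⁅τ, ρ a⁆ = ρ a' · (ρ a)⁻¹ = ρ (e^p)`
  have hconj : τ * ρ a * τ⁻¹ = ρ a' := by
    apply AlgEquiv.ext
    intro y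
    rw [AlgEquiv.mul_apply, AlgEquiv.mul_apply, hρ, hρ, ha']
    rfl
  have hcomm : ⁅τ, ρ a⁆ = ρ (e ^ p) := by
    rw [commutatorElement_def, hconj, he, map_mul, mul_assoc, mul_inv_cancel, mul_one]
  rw [hcomm, map_pow]
  exact Subgroup.subset_closure ⟨ρ e, ⟨e, rfl⟩, rfl⟩

end Tower

end Literature.NumberTheory.NumberFields.hilbertClassField

end
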